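import Literature.NumberTheory.Automorphic.SplitTorusOrderSelfDualTorsor       -- ★ O8a-1 p845496 (F0P3b-p01): `Ru`, `C := Ru.comap N`, `mem_units_adjoin_iff`, `norm_units_apply`
import Literature.NumberTheory.Automorphic.VandermondeLatticeIndex              -- ★ O1∘O2 p845514 (F0P3-p02): integral-level `Algebra.adjoin 𝒪[F] {γ}`, `isLocalRing_toSubring_of_forall_sub_apply_mem`, `sub_apply_mem_maximalIdeal_of_mem_adjoin_singleton`
import Literature.RingTheory.GaloisAlgebras.QuadraticInvolutionDescentIndex    -- ★ O3∕O4 p845461 (this seat): `relIndex_inf_fixed_sq_eq_relIndex`, `index_comap_eq_of_surjective`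
import Literature.NumberTheory.LocalFields.UnramifiedQuadraticNormAtInertPlace  -- ★ `exists_mul_map_eq_of_isUnit_integer` («`U_K = N U_L`», inert token `hmove`)
import HarnessLib

/-!
# T3′ seam Σ2-F «THE `F`-SIDE ORDER»: the σ-fixed part of `𝒪_E[γ]` read in `𝒪_Fⁿ` — constants, locality, the additive index `[𝒪_Fⁿ : R^σ]² = [𝒪_Eⁿ : R]`, and the norm-fibre
# index `[(𝒪_E^×)ⁿ : C] = [(𝒪_F^×)ⁿ : R^{σ×}]` at an inert place (Serre, *Local Fields*, Ch. V §2 Prop. 3; Neukirch, *ANT*, Ch. I §12)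

Topic `NumberTheory/Automorphic`; namespace `Literature.NumberTheory.Automorphic`.  THEOREMS ONLY (no definition, no instance, no notation, no named fact, no `sorry`).  Seat A-p19 (g25).  Road «S3-tree» T3′ (F0P3b-p01 (g11)
DESIGN v2 §2 (P-1)), the F-half of the unit-index seam (F0P3-p02 (g14) 16:55:44Z O8a-5E = E-half): CURRENCY = (D0) `ValuativeRel` with TWO valued fields `F` (the fixed field) and
`E` (where the norm-one nodes `γ` live), `ι : F →+* E` onto `E^σ`, `ιO : 𝒪[F] →+* 𝒪[E]` its integral restriction (binders `hιO`, `hιO'`, `hfix` = the inert-place dictionary, discharged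
at `(F_v, E_w, toPlace v w)` by ★ `valued_toPlace`, ★ `exists_toPlace_eq_of_galAdicCompletionMap_eq`).  TOKENS: O8a-1's `Ru := (Algebra.adjoin 𝒪[E] {γ}).toSubmonoid.units ≤ (Fin n → E)ˣ`,
`N := id * Units.map (σ componentwise)`, `C := Ru.comap N`; O2's integral-level `Subring (Fin n → 𝒪[F])` with `hconst` ∕ `[IsLocalRing]` ∕ `.toAddSubgroup.index`; the F-SIDE ORDER
**`RF := (Algebra.adjoin 𝒪[E] {γ}).toSubring.comap ιOn`**, `ιOn := RingHom.pi (fun i => (𝒪[E].subtype.comp ιO).comp (Pi.evalRingHom _ i)) : (Fin n → 𝒪[F]) →+* (Fin n → E)`.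
HONEST LABEL: HC_CM is proved only modulo the 2 remaining named inputs (hLiu418 24832, h413 24833) until rung 0 closes; generic algebra + ★ norm surjectivity, asserts nothing printed.
-/

set_option autoImplicit false

noncomputable section

open scoped ValuativeRel
open Polynomial Finset

namespace Literature.NumberTheory.Automorphic

variable {F E : Type*} [Field F] [ValuativeRel F] [Field E] [ValuativeRel E] {n : ℕ}
  (ι : F →+* E) (ιO : 𝒪[F] →+* 𝒪[E]) (σ : E →+* E)

/-- **Σ2-F (a) CONSTANTS**: `RF` contains the constant vectors `(a, …, a)`, `a ∈ 𝒪[F]` (O2's `hconst`). [cite: Neukirch1999, Ch. I §12] -/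
theorem const_mem_comap_adjoin (γ : Fin n → E) (a : 𝒪[F]) :
    (fun _ : Fin n => a) ∈ (Algebra.adjoin 𝒪[E] ({γ} : Set (Fin n → E))).toSubring.comap
      (RingHom.pi fun i : Fin n => ((𝒪[E]).subtype.comp ιO).comp (Pi.evalRingHom (fun _ : Fin n => 𝒪[F]) i)) := by
  rw [Subring.mem_comap, Subalgebra.mem_toSubring]
  have h : (RingHom.pi fun i : Fin n => ((𝒪[E]).subtype.comp ιO).comp (Pi.evalRingHom (fun _ : Fin n => 𝒪[F]) i)) (fun _ : Fin n => a) =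
      algebraMap 𝒪[E] (Fin n → E) (ιO a) := by
    funext i; rfl
  rw [h]
  exact Subalgebra.algebraMap_mem _ _

/-- **Σ2-F (b) LOCALITY**: if the nodes are pairwise congruent (`γ_i − γ_j ∈ 𝔪_E`, e.g. `γ` residually unipotent), `n ≥ 1`, and `ιO` detects non-units (`ιO x ∈ 𝔪_E → x ∈ 𝔪_F`:
the integral dictionary), then `RF` is a LOCAL ring (O2's `[IsLocalRing R]`; ★ `isLocalRing_toSubring_of_forall_sub_apply_mem` pattern). [cite: Neukirch1999, Ch. I §12] -/
theorem isLocalRing_comap_adjoin (hn : 0 < n) (hιm : ∀ x : 𝒪[F], ιO x ∈ IsLocalRing.maximalIdeal 𝒪[E] → x ∈ IsLocalRing.maximalIdeal 𝒪[F])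
    (γ : Fin n → E) (hγ : ∀ i, γ i ∈ 𝒪[E]) (hγc : ∀ i j, (⟨γ i, hγ i⟩ : 𝒪[E]) - ⟨γ j, hγ j⟩ ∈ IsLocalRing.maximalIdeal 𝒪[E]) :
    IsLocalRing ((Algebra.adjoin 𝒪[E] ({γ} : Set (Fin n → E))).toSubring.comap
      (RingHom.pi fun i : Fin n => ((𝒪[E]).subtype.comp ιO).comp (Pi.evalRingHom (fun _ : Fin n => 𝒪[F]) i))) := by
  classical
  set φ : (Fin n → 𝒪[F]) →+* (Fin n → E) := RingHom.pi fun i : Fin n => ((𝒪[E]).subtype.comp ιO).comp (Pi.evalRingHom (fun _ : Fin n => 𝒪[F]) i) with hφ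
  set RF : Subring (Fin n → 𝒪[F]) := (Algebra.adjoin 𝒪[E] ({γ} : Set (Fin n → E))).toSubring.comap φ with hRF
  have hφi : ∀ (x : Fin n → 𝒪[F]) (i : Fin n), φ x i = ((ιO (x i) : 𝒪[E]) : E) := fun _ _ => rfl
  -- the `𝒪[F]`-subalgebra structure on `RF` (constants lie in it)
  have hconst : ∀ a : 𝒪[F], (fun _ : Fin n => a) ∈ RF := fun a => const_mem_comap_adjoin ιO γ a
  let S : Subalgebra 𝒪[F] (Fin n → 𝒪[F]) :=
    { carrier := RF
      mul_mem' := fun ha hb => RF.mul_mem ha hb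
      one_mem' := RF.one_mem
      add_mem' := fun ha hb => RF.add_mem ha hb
      zero_mem' := RF.zero_mem
      algebraMap_mem' := fun a => hconst a }
  -- coordinates of elements of `RF` are pairwise congruent modulo `𝔪_F`
  have hcong : ∀ x ∈ S, ∀ i j : Fin n, x i - x j ∈ IsLocalRing.maximalIdeal 𝒪[F] := by
    intro x hx i j
    have hxR : φ x ∈ Algebra.adjoin 𝒪[E] ({γ} : Set (Fin n → E)) := by
      have h : x ∈ RF := hx
      rw [hRF, Subring.mem_comap, Subalgebra.mem_toSubring] at h
      exact h
    rw [mem_adjoin_singleton_iff_mem_span_pow 𝒪[E] hγ] at hxR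
    obtain ⟨p, hp⟩ := exists_poly_of_mem_span_pow 𝒪[E] hxR
    apply hιm
    -- `ιO (x i − x j) = p(γ_i) − p(γ_j) ∈ 𝔪_E`
    have hdvd : (⟨γ i, hγ i⟩ : 𝒪[E]) - ⟨γ j, hγ j⟩ ∣ p.eval ⟨γ i, hγ i⟩ - p.eval ⟨γ j, hγ j⟩ := Polynomial.sub_dvd_eval_sub _ _ _
    have hmem : p.eval ⟨γ i, hγ i⟩ - p.eval ⟨γ j, hγ j⟩ ∈ IsLocalRing.maximalIdeal 𝒪[E] := Ideal.mem_of_dvd _ hdvd (hγc i j)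
    have heval : ∀ k : Fin n, ((p.eval ⟨γ k, hγ k⟩ : 𝒪[E]) : E) = ((ιO (x k) : 𝒪[E]) : E) := fun k => by
      have h1 : (p.map (𝒪[E]).subtype).eval (γ k) = ((p.eval ⟨γ k, hγ k⟩ : 𝒪[E]) : E) := by
        rw [Polynomial.eval_map]
        exact Polynomial.eval₂_at_apply (𝒪[E]).subtype ⟨γ k, hγ k⟩
      rw [← h1, hp k, hφi]
    have hi' : ιO (x i) = p.eval ⟨γ i, hγ i⟩ := Subtype.ext (heval i).symm
    have hj' : ιO (x j) = p.eval ⟨γ j, hγ j⟩ := Subtype.ext (heval j).symm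
    rw [map_sub, hi', hj']
    exact hmem
  haveI hloc := isLocalRing_toSubring_of_forall_sub_apply_mem S hn hcong
  have hSR : S.toSubring = RF := SetLike.ext fun x => Iff.rfl
  exact IsLocalRing.of_surjective' (RingEquiv.subringCongr hSR).toRingHom (RingEquiv.subringCongr hSR).surjective

/-- **Σ2-F (c) THE ADDITIVE INDEX `[𝒪_Fⁿ : RF]² = [𝒪_Eⁿ : R]`** (`R` = the order at the integral level of `E`, `RE := (Algebra.adjoin 𝒪[E] {γ}).toSubring.comap (coeⁿ)`): the iso
`ιOn : 𝒪_Fⁿ ≃ (𝒪_Eⁿ)^σ` carries `RF` onto `R^σ`, then ★ O3 (b) `relIndex_inf_fixed_sq_eq_relIndex` (`IsUnit (2 : 𝒪[E])`, a skew unit `δ`).  With O1 (`[𝒪_Eⁿ : R] = q_E^{S}`, `q_E = q_F²`)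
this is O2's `hS` for `RF` with the SAME `S`. [cite: Serre1979, Ch. X §1 Prop. 3] [cite: Neukirch1999, Ch. I §12] -/
theorem index_comap_adjoin_sq (hιO : ∀ x : 𝒪[F], ((ιO x : 𝒪[E]) : E) = ι x)
    (hfixO : ∀ y : 𝒪[E], σ y = y → ∃ x, ιO x = y) (hσι : ∀ x : F, σ (ι x) = ι x)
    (hσσ : ∀ a, σ (σ a) = a) (hσO : ∀ a ∈ 𝒪[E], σ a ∈ 𝒪[E]) (h2 : IsUnit (2 : 𝒪[E])) (δ : 𝒪[E]) (hδ : IsUnit δ) (hσδ : σ (δ : E) = -(δ : E))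
    (γ : Fin n → E) (hσγ : ∀ x ∈ Algebra.adjoin 𝒪[E] ({γ} : Set (Fin n → E)), (fun i => σ (x i)) ∈ Algebra.adjoin 𝒪[E] ({γ} : Set (Fin n → E))) :
    ((Algebra.adjoin 𝒪[E] ({γ} : Set (Fin n → E))).toSubring.comap
        (RingHom.pi fun i : Fin n => ((𝒪[E]).subtype.comp ιO).comp (Pi.evalRingHom (fun _ : Fin n => 𝒪[F]) i))).toAddSubgroup.index ^ 2 =
      ((Algebra.adjoin 𝒪[E] ({γ} : Set (Fin n → E))).toSubring.comap
        (RingHom.pi fun i : Fin n => (𝒪[E]).subtype.comp (Pi.evalRingHom (fun _ : Fin n => 𝒪[E]) i))).toAddSubgroup.index := by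
  classical
  -- tokens inside `V := Fin n → E`
  set A : Subalgebra 𝒪[E] (Fin n → E) := Algebra.adjoin 𝒪[E] ({γ} : Set (Fin n → E)) with hA
  set M : Submodule 𝒪[E] (Fin n → E) := Subalgebra.toSubmodule A with hM
  set coen : (Fin n → 𝒪[E]) →+* (Fin n → E) := RingHom.pi fun i : Fin n => (𝒪[E]).subtype.comp (Pi.evalRingHom (fun _ : Fin n => 𝒪[E]) i) with hcoen
  set ιOn : (Fin n → 𝒪[F]) →+* (Fin n → E) := RingHom.pi fun i : Fin n => ((𝒪[E]).subtype.comp ιO).comp (Pi.evalRingHom (fun _ : Fin n => 𝒪[F]) i) with hιOn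
  set Fix : AddSubgroup (Fin n → E) :=
    (RingHom.eqLocus (RingHom.pi (fun i => σ.comp (Pi.evalRingHom (fun _ : Fin n => E) i))) (RingHom.id (Fin n → E))).toAddSubgroup with hFix
  set On : AddSubgroup (Fin n → E) := AddSubgroup.pi Set.univ fun _ : Fin n => (𝒪[E]).toAddSubgroup with hOn
  have memFix : ∀ x : Fin n → E, x ∈ Fix ↔ ∀ i, σ (x i) = x i := fun x => by
    rw [hFix, Subring.mem_toAddSubgroup, RingHom.mem_eqLocus]
    exact ⟨fun h i => by simpa using congrFun h i, fun h => funext fun i => by simpa using h i⟩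
  have memOn : ∀ x : Fin n → E, x ∈ On ↔ ∀ i, x i ∈ 𝒪[E] := fun x => by
    rw [hOn, AddSubgroup.mem_pi]; simp
  have hMA : M.toAddSubgroup = A.toSubring.toAddSubgroup := rfl
  -- ★ O3 (b)
  have hMσ : ∀ x ∈ M, (fun i => σ (x i)) ∈ M := fun x hx => hσγ x hx
  have hO3 := Literature.RingTheory.GaloisAlgebras.relIndex_inf_fixed_sq_eq_relIndex σ 𝒪[E] hσσ hσO h2 δ hδ hσδ M hMσ
  -- the E-side transport along `coen` (injective, range `On`)
  have hcoen_range : (⊤ : AddSubgroup (Fin n → 𝒪[E])).map coen.toAddMonoidHom = On := by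
    ext y
    rw [AddSubgroup.mem_map, memOn]
    constructor
    · rintro ⟨x, -, rfl⟩ i
      exact (x i).2
    · intro hy
      exact ⟨fun i => ⟨y i, hy i⟩, AddSubgroup.mem_top _, funext fun i => rfl⟩
  have hRE : (A.toSubring.comap coen).toAddSubgroup = M.toAddSubgroup.comap coen.toAddMonoidHom := by
    ext x; exact Iff.rfl
  have hE : (A.toSubring.comap coen).toAddSubgroup.index = M.toAddSubgroup.relIndex On := by
    rw [← AddSubgroup.relIndex_top_right, hRE, AddSubgroup.relIndex_comap, hcoen_range]
  -- the F-side transport along `ιOn` (injective, range `On ⊓ Fix`)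
  have hιOn_apply : ∀ (x : Fin n → 𝒪[F]) (i : Fin n), ιOn x i = ((ιO (x i) : 𝒪[E]) : E) := fun _ _ => rfl
  have hιOn_range : (⊤ : AddSubgroup (Fin n → 𝒪[F])).map ιOn.toAddMonoidHom = On ⊓ Fix := by
    ext y
    rw [AddSubgroup.mem_map, AddSubgroup.mem_inf, memOn, memFix]
    constructor
    · rintro ⟨x, -, rfl⟩
      refine ⟨fun i => ?_, fun i => ?_⟩
      · exact (ιO (x i)).2
      · change σ (((ιO (x i) : 𝒪[E]) : E)) = ((ιO (x i) : 𝒪[E]) : E)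
        rw [hιO, hσι]
    · rintro ⟨hyO, hyσ⟩
      have hex : ∀ i, ∃ x : 𝒪[F], ιO x = ⟨y i, hyO i⟩ := fun i => hfixO ⟨y i, hyO i⟩ (hyσ i)
      choose x hx using hex
      refine ⟨x, AddSubgroup.mem_top _, funext fun i => ?_⟩
      change (((ιO (x i) : 𝒪[E]) : E)) = y i
      rw [hx i]
  have hRF : (A.toSubring.comap ιOn).toAddSubgroup = M.toAddSubgroup.comap ιOn.toAddMonoidHom := by
    ext x; exact Iff.rfl
  have hF : (A.toSubring.comap ιOn).toAddSubgroup.index = (M.toAddSubgroup ⊓ Fix).relIndex (On ⊓ Fix) := by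
    rw [← AddSubgroup.relIndex_top_right, hRF, AddSubgroup.relIndex_comap, hιOn_range]
    have h1 : (M.toAddSubgroup ⊓ Fix) ⊓ (On ⊓ Fix) = M.toAddSubgroup ⊓ (On ⊓ Fix) := by
      rw [inf_assoc, inf_left_comm Fix On Fix, inf_idem]
    rw [← AddSubgroup.inf_relIndex_right (M.toAddSubgroup ⊓ Fix), h1, AddSubgroup.inf_relIndex_right]
  rw [hF, hE]
  exact hO3

/-- **Σ2-F (d) THE NORM-FIBRE INDEX `[(𝒪_E^×)ⁿ : C ∩ (𝒪_E^×)ⁿ] = [(𝒪_F^×)ⁿ : RF^×]`** in O8a-1's tokens: with `G := (Units.map coeⁿ).range ≤ (Fin n → E)ˣ` (= `(𝒪_E^×)ⁿ`),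
`C := Ru.comap N`: `C.relIndex G = (Units.map RF.subtype).range.index` (in `(Fin n → 𝒪[F])ˣ`) — ★ O4 (a) for the surjection `N : G → G^σ` (onto by ★ «`U_K = N U_L`»
`exists_mul_map_eq_of_isUnit_integer`, inert token `hmove`) and the transport `G^σ ≃ (𝒪_F^×)ⁿ` along `ιO`. [cite: Serre1979, Ch. V §2 Prop. 3, Corollary and Remark 1] -/
theorem relIndex_comap_norm_eq_index_units_fixedSide [UniformSpace E] [IsUniformAddGroup E] [IsNonarchimedeanLocalField E]
    (hιO : ∀ x : 𝒪[F], ((ιO x : 𝒪[E]) : E) = ι x) (hιinj : Function.Injective ιO)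
    (hfixO : ∀ y : 𝒪[E], σ y = y → ∃ x, ιO x = y) (hσι : ∀ x : F, σ (ι x) = ι x)
    (hσσ : ∀ a, σ (σ a) = a) (hσO : ∀ a : 𝒪[E], σ a ∈ 𝒪[E]) (hmove : ∃ a : 𝒪[E], IsUnit ((⟨σ a, hσO a⟩ : 𝒪[E]) - a))
    (γ : Fin n → E) :
    (((Algebra.adjoin 𝒪[E] ({γ} : Set (Fin n → E))).toSubmonoid.units).comap
        (MonoidHom.id (Fin n → E)ˣ * (Units.map (RingHom.pi fun i : Fin n => σ.comp (Pi.evalRingHom (fun _ : Fin n => E) i)).toMonoidHom))).relIndex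
        (Units.map (RingHom.pi fun i : Fin n => (𝒪[E]).subtype.comp (Pi.evalRingHom (fun _ : Fin n => 𝒪[E]) i)).toMonoidHom).range =
      (Units.map ((Algebra.adjoin 𝒪[E] ({γ} : Set (Fin n → E))).toSubring.comap
        (RingHom.pi fun i : Fin n => ((𝒪[E]).subtype.comp ιO).comp (Pi.evalRingHom (fun _ : Fin n => 𝒪[F]) i))).subtype.toMonoidHom).range.index := by
  classical
  -- tokens
  set A : Subalgebra 𝒪[E] (Fin n → E) := Algebra.adjoin 𝒪[E] ({γ} : Set (Fin n → E)) with hA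
  set coen : (Fin n → 𝒪[E]) →+* (Fin n → E) := RingHom.pi fun i : Fin n => (𝒪[E]).subtype.comp (Pi.evalRingHom (fun _ : Fin n => 𝒪[E]) i) with hcoen
  set ιOn : (Fin n → 𝒪[F]) →+* (Fin n → E) := RingHom.pi fun i : Fin n => ((𝒪[E]).subtype.comp ιO).comp (Pi.evalRingHom (fun _ : Fin n => 𝒪[F]) i) with hιOn
  set Nh : (Fin n → E)ˣ →* (Fin n → E)ˣ :=
    MonoidHom.id (Fin n → E)ˣ * (Units.map (RingHom.pi fun i : Fin n => σ.comp (Pi.evalRingHom (fun _ : Fin n => E) i)).toMonoidHom) with hNh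
  set Ru : Subgroup (Fin n → E)ˣ := A.toSubmonoid.units with hRu
  set C : Subgroup (Fin n → E)ˣ := Ru.comap Nh with hC
  set G : Subgroup (Fin n → E)ˣ := (Units.map coen.toMonoidHom).range with hG
  set RF : Subring (Fin n → 𝒪[F]) := A.toSubring.comap ιOn with hRF
  set fU : (Fin n → 𝒪[F])ˣ →* (Fin n → E)ˣ := Units.map ιOn.toMonoidHom with hfU
  set GF : Subgroup (Fin n → E)ˣ := fU.range with hGF
  set HF : Subgroup (Fin n → 𝒪[F])ˣ := (Units.map RF.subtype.toMonoidHom).range with hHF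
  have hιOn_apply : ∀ (x : Fin n → 𝒪[F]) (i : Fin n), ιOn x i = ((ιO (x i) : 𝒪[E]) : E) := fun _ _ => rfl
  have hcoen_apply : ∀ (x : Fin n → 𝒪[E]) (i : Fin n), coen x i = ((x i : 𝒪[E]) : E) := fun _ _ => rfl
  have hN_apply : ∀ (c : (Fin n → E)ˣ) (i : Fin n), ((Nh c : (Fin n → E)ˣ) : Fin n → E) i = (c : Fin n → E) i * σ ((c : Fin n → E) i) :=
    fun c i => norm_units_apply σ c i
  have hRu_iff : ∀ u : (Fin n → E)ˣ, u ∈ Ru ↔ (u : Fin n → E) ∈ A ∧ ((u⁻¹ : (Fin n → E)ˣ) : Fin n → E) ∈ A := fun u => by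
    rw [hRu, Submonoid.mem_units_iff]; rfl
  have hRF_iff : ∀ x : Fin n → 𝒪[F], x ∈ RF ↔ ιOn x ∈ A := fun x => by
    rw [hRF, Subring.mem_comap, Subalgebra.mem_toSubring]
  -- `ιOn` is injective, hence so is `fU`
  have hιOn_inj : Function.Injective ιOn := by
    intro x y hxy
    funext i
    have h := congrFun hxy i
    rw [hιOn_apply, hιOn_apply] at h
    exact hιinj (Subtype.ext h)
  have hfU_inj : Function.Injective fU := by
    intro x y hxy
    apply Units.ext
    apply hιOn_inj
    exact congrArg (fun u : (Fin n → E)ˣ => (u : Fin n → E)) hxy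
  -- (d2)+(d3)+(d4): the F-side transport `HF.index = Ru.relIndex GF`
  have hHF_map : HF.map fU = Ru ⊓ GF := by
    ext u
    rw [Subgroup.mem_map, Subgroup.mem_inf, hRu_iff]
    constructor
    · rintro ⟨x, hx, rfl⟩
      obtain ⟨y, rfl⟩ := hx
      refine ⟨⟨?_, ?_⟩, ⟨_, rfl⟩⟩
      · have h1 : ((fU (Units.map RF.subtype.toMonoidHom y) : (Fin n → E)ˣ) : Fin n → E) = ιOn ((y : RF) : Fin n → 𝒪[F]) := rfl
        rw [h1, ← hRF_iff]; exact (y : RF).2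
      · have h1 : (((fU (Units.map RF.subtype.toMonoidHom y))⁻¹ : (Fin n → E)ˣ) : Fin n → E) = ιOn ((y⁻¹ : RFˣ) : RF) := by
          rw [← map_inv, ← map_inv]; rfl
        rw [h1, ← hRF_iff]; exact ((y⁻¹ : RFˣ) : RF).2
    · rintro ⟨⟨hu, hui⟩, ⟨x, rfl⟩⟩
      have hx1 : (x : Fin n → 𝒪[F]) ∈ RF := by
        rw [hRF_iff]; exact hu
      have hx2 : ((x⁻¹ : (Fin n → 𝒪[F])ˣ) : Fin n → 𝒪[F]) ∈ RF := by
        rw [hRF_iff]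
        have h1 : ιOn ((x⁻¹ : (Fin n → 𝒪[F])ˣ) : Fin n → 𝒪[F]) = (((fU x)⁻¹ : (Fin n → E)ˣ) : Fin n → E) := by rw [← map_inv]; rfl
        rw [h1]; exact hui
      refine ⟨x, ⟨⟨⟨(x : Fin n → 𝒪[F]), hx1⟩, ⟨((x⁻¹ : (Fin n → 𝒪[F])ˣ) : Fin n → 𝒪[F]), hx2⟩, Subtype.ext x.mul_inv, Subtype.ext x.inv_mul⟩,
        Units.ext rfl⟩, rfl⟩
  have hHF_index : HF.index = Ru.relIndex GF := by
    rw [← Subgroup.inf_relIndex_right Ru, ← hHF_map, hGF, MonoidHom.range_eq_map, Subgroup.relIndex_map_map_of_injective HF ⊤ hfU_inj,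
      Subgroup.relIndex_top_right]
  -- units of `𝒪[E]`: `σ` preserves them; `ιO` reflects them
  have hσunit : ∀ a : 𝒪[E], IsUnit a → IsUnit (⟨σ a, hσO a⟩ : 𝒪[E]) := by
    intro a ha
    obtain ⟨b, hb⟩ := ha.exists_right_inv
    refine IsUnit.of_mul_eq_one ⟨σ b, hσO b⟩ (Subtype.ext ?_)
    show σ (a : E) * σ (b : E) = 1
    rw [← map_mul, show (a : E) * (b : E) = ((a * b : 𝒪[E]) : E) from rfl, hb, OneMemClass.coe_one, map_one]
  have hιO_unit : ∀ z : 𝒪[F], IsUnit (ιO z) → σ ((ιO z : 𝒪[E]) : E) = ιO z → IsUnit z := by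
    intro z hz _
    obtain ⟨w, hw⟩ := hz.exists_right_inv
    -- `w = (ιO z)⁻¹` is σ-fixed, hence comes from `𝒪[F]`
    have hσw : σ (w : E) = w := by
      have hzE : ((ιO z : 𝒪[E]) : E) ≠ 0 := fun h0 => by
        have := congrArg (fun t : 𝒪[E] => (t : E)) hw
        simp only [Subring.coe_mul, h0, zero_mul, OneMemClass.coe_one] at this
        exact zero_ne_one this
      have hwE : (w : E) = (((ιO z : 𝒪[E]) : E))⁻¹ := by
        refine (eq_inv_of_mul_eq_one_right ?_)
        have := congrArg (fun t : 𝒪[E] => (t : E)) hw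
        simpa only [Subring.coe_mul, OneMemClass.coe_one] using this
      rw [hwE, map_inv₀, hιO, hσι]
    obtain ⟨z', hz'⟩ := hfixO w hσw
    refine IsUnit.of_mul_eq_one z' (hιinj ?_)
    rw [map_mul, hz', hw, map_one]
  -- the norm maps `G` into `GF`
  have hNG : ∀ g ∈ G, Nh g ∈ GF := by
    rintro _ ⟨x, rfl⟩
    -- coordinates of the norm: σ-fixed units of `𝒪[E]`
    have hxi : ∀ i, IsUnit ((x : Fin n → 𝒪[E]) i) := fun i => (x.isUnit.map (Pi.evalMonoidHom (fun _ : Fin n => 𝒪[E]) i))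
    have hui : ∀ i, IsUnit ((x : Fin n → 𝒪[E]) i * ⟨σ ((x : Fin n → 𝒪[E]) i), hσO _⟩) := fun i => (hxi i).mul (hσunit _ (hxi i))
    have hσui : ∀ i, σ ((((x : Fin n → 𝒪[E]) i * ⟨σ ((x : Fin n → 𝒪[E]) i), hσO _⟩ : 𝒪[E]) : E)) =
        (((x : Fin n → 𝒪[E]) i * ⟨σ ((x : Fin n → 𝒪[E]) i), hσO _⟩ : 𝒪[E]) : E) := fun i => by
      simp only [Subring.coe_mul, map_mul, hσσ]; ring
    have hex : ∀ i, ∃ z : (𝒪[F])ˣ, ιO (z : 𝒪[F]) = (x : Fin n → 𝒪[E]) i * ⟨σ ((x : Fin n → 𝒪[E]) i), hσO _⟩ := by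
      intro i
      obtain ⟨z, hz⟩ := hfixO _ (hσui i)
      have hzu : IsUnit z := hιO_unit z (hz ▸ hui i) (by rw [hz]; exact hσui i)
      exact ⟨hzu.unit, hz⟩
    choose z hz using hex
    refine ⟨MulEquiv.piUnits.symm z, Units.ext (funext fun i => ?_)⟩
    rw [hN_apply]
    change ((ιO (((MulEquiv.piUnits.symm z : (Fin n → 𝒪[F])ˣ) : Fin n → 𝒪[F]) i) : 𝒪[E]) : E) = _
    have hzi : ((MulEquiv.piUnits.symm z : (Fin n → 𝒪[F])ˣ) : Fin n → 𝒪[F]) i = (z i : 𝒪[F]) := rfl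
    rw [hzi, hz i]
    rfl
  -- the restricted norm `N' : G →* GF` is ONTO (★ `U_K = N U_L`)
  let N' : ↥G →* ↥GF := (Nh.restrict G).codRestrict GF fun g => hNG g g.2
  have hN'surj : Function.Surjective N' := by
    rintro ⟨_, ⟨y, rfl⟩⟩
    -- each coordinate `ιO (y i)` is a σ-fixed unit of `𝒪[E]`, hence a norm `s σ(s)` with `s` a unit
    have hyi : ∀ i, IsUnit ((y : Fin n → 𝒪[F]) i) := fun i => (y.isUnit.map (Pi.evalMonoidHom (fun _ : Fin n => 𝒪[F]) i))
    have hwi : ∀ i, IsUnit (ιO ((y : Fin n → 𝒪[F]) i)) := fun i => (hyi i).map ιO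
    have hσwi : ∀ i, σ ((ιO ((y : Fin n → 𝒪[F]) i) : 𝒪[E]) : E) = ιO ((y : Fin n → 𝒪[F]) i) := fun i => by rw [hιO, hσι]
    have hex : ∀ i, ∃ s : (𝒪[E])ˣ, ((s : 𝒪[E]) : E) * σ ((s : 𝒪[E]) : E) = ((ιO ((y : Fin n → 𝒪[F]) i) : 𝒪[E]) : E) := by
      intro i
      obtain ⟨s, hs⟩ := Literature.NumberTheory.LocalFields.UnramifiedQuadraticNorm.exists_mul_map_eq_of_isUnit_integer σ hσσ hσO hmove _ (hwi i) (hσwi i)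
      have hsu : IsUnit s := by
        obtain ⟨w, hw⟩ := (hwi i).exists_right_inv
        refine IsUnit.of_mul_eq_one (⟨σ (s : E), hσO s⟩ * w) (Subtype.ext ?_)
        have hw' : ((ιO ((y : Fin n → 𝒪[F]) i) : 𝒪[E]) : E) * (w : E) = 1 := by
          have := congrArg (fun t : 𝒪[E] => (t : E)) hw
          simpa only [Subring.coe_mul, OneMemClass.coe_one] using this
        show (s : E) * (σ (s : E) * (w : E)) = 1
        rw [← mul_assoc, hs, hw']
      exact ⟨hsu.unit, hs⟩
    choose s hs using hex
    refine ⟨⟨Units.map coen.toMonoidHom (MulEquiv.piUnits.symm s), ⟨_, rfl⟩⟩, Subtype.ext (Units.ext (funext fun i => ?_))⟩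
    show ((Nh (Units.map coen.toMonoidHom (MulEquiv.piUnits.symm s)) : (Fin n → E)ˣ) : Fin n → E) i = ((fU y : (Fin n → E)ˣ) : Fin n → E) i
    rw [hN_apply]
    change (((MulEquiv.piUnits.symm s : (Fin n → 𝒪[E])ˣ) : Fin n → 𝒪[E]) i : E) * σ (((MulEquiv.piUnits.symm s : (Fin n → 𝒪[E])ˣ) : Fin n → 𝒪[E]) i : E) =
      ((ιO ((y : Fin n → 𝒪[F]) i) : 𝒪[E]) : E)
    have hsi : ((MulEquiv.piUnits.symm s : (Fin n → 𝒪[E])ˣ) : Fin n → 𝒪[E]) i = (s i : 𝒪[E]) := rfl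
    rw [hsi, hs i]
  -- (d6) the pulled-back subgroup
  have hcomap : (Ru.subgroupOf GF).comap N' = C.subgroupOf G := by
    ext g
    rw [Subgroup.mem_comap, Subgroup.mem_subgroupOf, Subgroup.mem_subgroupOf, hC, Subgroup.mem_comap]
    exact Iff.rfl
  -- (d7) assemble
  have h1 : C.relIndex G = (C.subgroupOf G).index := rfl
  have h2 : Ru.relIndex GF = (Ru.subgroupOf GF).index := rfl
  rw [h1, ← hcomap, Subgroup.index_comap_of_surjective _ hN'surj, ← h2, ← hHF_index]

end Literature.NumberTheory.Automorphic

end
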